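import Mathlib
import Literature.MathematicalPhysics.QuantumFieldTheory.Balaban1983to89.B9Thm34Inv
import Literature.MathematicalPhysics.QuantumFieldTheory.Balaban1983to89.B9Thm37Sum

/-!
# `Balaban1983to89.B9Thm39Sum` — (3.95)–(3.96) and "This theorem implies Theorem 3.2" (B9, Theorem 3.9 pp. 411–413), kernel-checked at the kernel level on 𝔅

T. Bałaban, *Propagators for lattice gauge theories in a background field*, Commun. Math. Phys. **99**, 389–434
(1985) [Balaban1985BackgroundPropagators] (cell paper B9; PDF held `paper:balaban1985-cmp99-background-propagators`,
journal page = PDF page + 388).  Sibling of `…Balaban1983to89.B9` (UNTOUCHED: `B9.Thm39Printed`, `B9.Thm32Printed`,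
the leaf `B9.RWKernelSumYields` and `B9.thm32_of_thm39` over the abstract carriers), of `…B9Thm34Inv` (whose kernel
vocabulary on the finite set 𝔅 — `entry`, `ker`, `vol`, `hasMajorant_id_iff`, `isUnit_one_add_of_rowSum`,
`rowSum_le_of_majorant` — is reused) and of `…B9Thm37Sum` (whose walk bookkeeping — `mulOp`, `lprod`, `lchain`, `LB`,
`lchain_weight_le`, `walksFrom`, `card_walksFrom_le`, `hasMajorant_finsetSum`, `hasMajorant_sandwich_local` — is
reused), all built on the block-majorant calculus of [4] = [Balaban1984PropagatorsII] typed by unit pv08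
(`…B6RandomWalk`: `HasMajorant`, `Ineq261`, `majorant_of_fixedPoint_266`) and read through `B9Thm34Ext.toB6`.

CITATION HEADER (lean-in-tree rule 2026-08-18).  This module is a KERNEL-CHECKED BOOKKEEPING STEP of the published
paper [Balaban1985BackgroundPropagators], pp. 409, 411–413 [PDF 21, 23–25], verbatim:

(p. 409) *"The operators constructed for this sequence, which we denote by G′_□(U), C_□(U) = (Q′(U)G′²_□(U)Q′\*(U))⁻¹,
G_□(U), satisfy all the inequalities of Theorems 3.1–3.3 correspondingly. … We construct approximations G′₀, C₀, G₀
of the operators G′, (Q′G′²Q′\*)⁻¹, G taking G′₀ = Σ_{□∈𝒟} h_□G′_□h_□, C₀ = Σ_{□∈𝒟} h_□C_□h_□, G₀ = Σ_{□∈𝒟} h_□G_□h_□.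
(3.87)"*

(p. 411) *"Next let us consider the operator (Q′G′²Q′\*)⁻¹. We will find an expansion of this operator as usual
considering Q′G′²Q′\*C₀. We write it in the same way as in (2.82) [4]*
*Q′G′²Q′\*C₀ = I + Σ_□ (1 − □̃)Q′G′²Q′\*h_□C_□h_□ + Σ_□ □̃Q′(G′² − G′²_□)Q′\*h_□C_□h_□ + Σ_□ [□̃Q′G′²_□Q′\*, h_□]C_□h_□
= I − R   (3.95)*
*By the same estimates as in [4], especially (2.83)–(2.85), we can see that the operator R is small and*
*(Q′G′Q′\*)⁻¹ [sic: (Q′G′²Q′\*)⁻¹, census D-b09.5] = C₀(I − R)⁻¹ = Σ_{n=0}^∞ C₀Rⁿ.   (3.96)*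
*The series is convergent in the weighted supremum norm on 𝔅 appearing in the inequality (3.48) in Theorem 3.2. …
The characteristic function 1 − □̃ at the beginning of the term, and the function h_□ at the end, restrict a kernel
of the term to points separated at least by a distance ML^jη (if □ ∈ 𝒟_j). Hence the part of the exponential factor
can be estimated by e^{−(1/4)δ₀M} …"*

(p. 413) *"Theorem 3.9. For M sufficiently large, and a configuration U satisfying (3.35), the operator Q′G′²Q′\* has
an inverse which can be represented as (Q′G′²Q′\*)⁻¹ = Σ_ω R′₀(X₀)R′_{α₁}(X₁)·⋯·R′_{αₙ}(Xₙ)   (3.98)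
the sum is over walks ω = ((0, X₀), (α₁, X₁), …, (αₙ, Xₙ)) satisfying X_{i−1} ∩ Xᵢ ≠ ∅, i = 1, …, n. A term in this
expansion corresponding to a walk ω depends on U restructed [sic] to X̃⁵₀ ∪ X̃⁵₁ ∪ … ∪ X̃⁵ₙ, and has the following
bound: |(R′₀(X₀)R′_{α₁}(X₁)·⋯·R′_{αₙ}(Xₙ))(y, y′)| ≦ O(1)(L^jη)^{−4}(L^{j′}η)^{−d}·O(M^{−1/2})^{|ω|}M^{−½|ω|}
e^{−½δ₀d(ω,y,y′)}, y ∈ Λ_j, y′ ∈ Λ_{j′}.   (3.99)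
The distance d(ω, y, y′) is defined by (3.93), but the infimum is taken over yᵢ ∈ Xᵢ ∩ 𝔅. Let us remark that
generally the operators R′_α(X) act between different scales … hence not all combinations of indices αᵢ are
admissible. We have not included this fact into the description of the expansion (3.98) because it does not affect
bounds.  This theorem implies Theorem 3.2."*

with Theorem 3.2 (3.48) (p. 398, verbatim): *"|(Q′(U)G′²(U)Q′\*(U))⁻¹(y, y′)| ≦ B₀(L^jη)^{−4}(L^{j′}η)^{−d}
e^{−δ₀d(y,y′)}, y, y′∈𝔅 (y∈Λ_j, y′∈Λ_{j′})."*, and the cited template of [4] = [Balaban1984PropagatorsII] pp. 237–238: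
(2.82) *"We will show that Q′G′²Q′\*C is a good approximation of identity"*, (2.83) (the kernel estimate of the first
sum: *"= O(1)e^{−¼δ₀M}L^{4(j−j′)}e^{−¼δ₀RM max{|j−j′|−1,0}}e^{−δ₁d(y,y′)}(L^{j′}η)^{−d} ≦ O(1)e^{−⅛δ₀M}e^{−δ₁d(y,y′)}
(L^{j′}η)^{−d}"*), (2.85) *"|R(y, y′)| ≦ O(M^{−1})e^{−δ₁d(y,y′)}(L^{j′}η)^{−d}, y, y′ ∈ 𝔅, y′ ∈ Λ_{j′}, (2.85) and by
Lemma 2.1 we get Proposition 2.3. An inverse of the operator Q′G′²Q′\* is given by the convergent expansion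
(Q′G′²Q′\*)⁻¹ = C(I − R)⁻¹ = Σ_{n=0}^∞ CRⁿ = Σ_ω … (2.86) and it satisfies the estimate |(Q′G′²Q′\*)⁻¹(y, y′)| ≦
O(1)(L^jη)^{−4}(L^{j′}η)^{−d}e^{−½δ₁d(y,y′)} (2.87)"*; Lemma 2.1 of [4] p. 234: (2.61) *"sup_{y∈𝔅} Σ_{y′∈𝔅}
e^{−αδ₀d(y,y′)} ≦ c₁(α)"* (typed `B6RandomWalk.Ineq261`).

SETTING.  𝔅 = `g.Site` is FINITE (`[Fintype g.Site]`; the paper's lattices are finite tori); the operators of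
(3.95)–(3.99) restricted to functions on 𝔅 are `Module.End ℝ (g.Site → ℝ)`; a kernel "T(y, y′), y ∈ Λ_j, y′ ∈ Λ_{j′}"
is `B9Thm34Inv.ker (B9Thm34Inv.vol g d) T y y′`, the kernel w.r.t. the pairing weight (L^{j′}η)^d (so that the factor
(L^{j′}η)^{−d} of (3.48)/(3.99) is the reciprocal pairing weight, `B9Thm34Inv.ker_le_iff`), and pv08's block majorants
with the identity block map ARE entrywise bounds (`B9Thm34Inv.hasMajorant_id_iff`).

WHAT IS REPRODUCED (0 sorry; every O(·) a NAMED constant; every hypothesis of the printed shape, NAMED, none cited):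
* §1 `eq395_sum` — **(3.95) as an identity in any ring**: from the local inverse property
  h_□·□̃(Q′G′²_□Q′\*)·C_□·h_□ = h²_□ (`hloc`; `hloc_of_inverse` derives it from (Q′G′²_□Q′\*)C_□ = I and □̃h_□ = h_□ when
  the local problem is posed on the same space) and Σ_□ h²_□ = I (`hpu`, p. 408):
  L·Σ_□ h_□C_□h_□ = I + Σ_□(1 − □̃)L·h_□C_□h_□ + Σ_□ □̃(L − L_□)h_□C_□h_□ + Σ_□ (□̃L_□h_□ − h_□□̃L_□)C_□h_□ (L = Q′G′²Q′\*,
  L_□ = Q′G′²_□Q′\*), i.e. L·C₀ = I − R with R := −(the three sums) (`eq395_oneSub`) — the (2.82)-bookkeeping cited.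
* §2 `c0_majorant` — C₀ = Σ_□ h_□C_□h_□ inherits (3.48) from the C_□ (*"satisfy all the inequalities of Theorems
  3.1–3.3"*), LOCALIZED (|h_□| ≦ 1, supp h_□ ∩ 𝔅 ⊂ S_□, overlap #{□ : y ∈ S_□} ≦ N): entry majorant NB₀P(y)e^{−δ₀d(y,y′)},
  P(y) = (L^jη)^{−4};  `isUnit_one_sub_of_majorant`, `inverse_of_395`, `inverse_kernel_348_of_395` — **(3.96) with the
  smallness and the constants EXPLICIT**: if L·C₀ = I − R, C₀ has the entry majorant A·P(y)e^{−r·d(y,y′)}, R the entry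
  majorant θe^{−r·d(y,y′)} ((2.85)-shape: `hR`, a HYPOTHESIS — *"By the same estimates as in [4], especially
  (2.83)–(2.85)"* is by reference, cell GAPS G-B9-05/G-B9-07; §2b below kernel-checks the (2.83)-part), (2.61) of [4]
  holds at (r, α′) and θc₁(r, α′) < 1, then I − R is invertible (maximum principle on the finite set), T := C₀(I − R)⁻¹
  is a TWO-SIDED inverse of L (finite dimension), T = C₀ + T·R (the fixed-point form of Σ C₀Rⁿ), and T has the entry
  majorant A·c₁(1 − θc₁)⁻¹P(y)e^{−(1−α′)r·d(y,y′)} ([4] (2.66), pv08's `majorant_of_fixedPoint_266`); in the printed kernel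
  notation with θ = θ₀M⁻¹ and the LOCATED threshold **M ≧ 2θ₀c₁(r, α′)**: |T(y, y′)| ≦ 2A·c₁(r,α′)(L^jη)^{−4}(L^{j′}η)^{−d}
  e^{−(1−α′)r·d(y,y′)} — (3.48) with B₀ ↦ 2Ac₁, δ₀ ↦ (1 − α′)r.
* §2b `firstSum_term_majorant`, `firstSum_majorant` — **the (2.83)-estimate of [4] for the FIRST sum of (3.95)**,
  kernel-checked: if L has the entry majorant κ(L^jη)⁴e^{−a_Lδ₀d(y,y″)} (the upper bound for Q′G′²Q′\*: HYPOTHESIS `hL`),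
  h_□C_□h_□ the two-sided-localized (3.48)-majorant 1_{S_□}(y″)1_{S_□}(y′)B₀(L^{j″}η)^{−4}e^{−bδ₀d(y″,y′)}
  (`hasMajorant_sandwich_local₂`), the points outside □̃ and the points of S_□ are separated, d(y, y″) ≧ D_sep
  (*"separated at least by a distance ML^jη"*: `hsep`), the scale transfer of the p. 398 remark holds at exponent α_st
  with constant C ([4] (2.60): `B9Ineq347.ScaleTransfer`, C = L⁴) and a_L ≧ α_st + a_sep + ρ (a_sep, ρ ≧ 0), then the
  □-term
  (1 − □̃)L·h_□C_□h_□ has the entry majorant 1_{y∉□̃}1_{S_□}(y′)·κB₀C·c₁(δ₀, b−ρ)·e^{−a_sepδ₀D_sep}·e^{−ρδ₀d(y,y′)}, and the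
  first sum of (3.95) the entry majorant N·κB₀C·c₁·e^{−a_sepδ₀D_sep}·e^{−ρδ₀d(y,y′)} — (2.85)-shape with
  **O(M⁻¹) ↤ NκB₀Cc₁e^{−a_sepδ₀D_sep} ≦ NκB₀Cc₁(a_sepδ₀D_sep)⁻¹** (`firstSum_small_factor`: e^{−s} ≦ s⁻¹, gen-1's
  `B9.exp_neg_le_inv`; D_sep ≍ M in print).
* §3 `term399_majorant` — the (3.99)-SHAPE bound of a walk term from factor majorants (Corollary 3.8's mechanism,
  gen-4's `cor38_walk_majorant` with the head weight O(1)(L^jη)² generalized to any W₀(y) ≧ 0, here O(1)(L^jη)^{−4});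
  `walkSum_majorant_weight` — **the sum over the walks of (3.98)** (Proposition 1.2 [3] route: ≦ Dⁿ walks of length n
  from a start factor, `B9Thm37Sum.card_walksFrom_le`; overlap of the start localizations ≦ N; Dq ≦ ½ = *"M sufficiently
  large"*): every partial sum has the majorant 2N·W(y)e^{−δ′d(y,y′)};  `partialSum_kernel_348` — the same in the
  printed kernel notation: **every partial sum of (3.98) with the term bounds (3.99) satisfies (3.48) with B₀ ↦ 2NA,
  δ₀ ↦ δ′ = ½δ₀**;  `kernel_bound_of_limit` + `thm32_of_thm39_kernel` — **"This theorem implies Theorem 3.2"**: if the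
  partial sums of (3.98) converge kernelwise on the finite set 𝔅 (= *"convergent in the weighted supremum norm on 𝔅"*)
  to the inverse T of Q′G′²Q′\*, then T satisfies (3.48) with those constants.  This is the kernel-level content of the
  abstract leaf `B9.RWKernelSumYields` / `B9.thm32_of_thm39` of the sibling (NOT linked: see below).

WHAT IS NOT REPRODUCED (located, not claimed): (i) the smallness of the second and third sums of (3.95) — the bound
(3.97) for G′_{□₁} − G′_{□₂} from [2] and the commutator [□̃Q′G′²_□Q′\*, h_□] = O(M⁻¹) (cell GAPS G-B9-05, G-B9-07; prose
certification C-adv4-20 (c)–(e)); they enter §2 only through the hypothesis `hR` (`r_majorant_of_three` adds the three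
up); (ii) the upper bound `hL` for the kernel of Q′G′²Q′\* from (3.42) and the local bounds (3.48) for C_□ (Theorem 3.2
for the local operators, by the induction of Sect. C) — hypotheses; (iii) the re-expansion of G′ inside (3.96) by
(3.90)/(3.97) and the 𝒟′-localization combinatorics of pp. 411–412 that turn Σ C₀Rⁿ into the walk sum (3.98) — §3 takes
the walk-indexed family W ω with its successor structure (X_{i−1} ∩ Xᵢ ≠ ∅, ≦ D successors) and the term bounds
(3.99) as data/hypotheses, exactly as the sibling's `B9.RWKernelExpansion` does; (iv) the identification of the
limit of the partial sums with the inverse (hypothesis `hconv`; on the finite set 𝔅 norm convergence = kernelwise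
convergence); (v) heteromorphic factors (R′_α(X) *"act between different scales"*, p. 413) — §3's per-term theorem is
typed for factors on one function space, as gen-4's; the walk SUM needs only the term bounds; (vi) (2.60)/(2.61) of [4]
for THIS geometry and the metric facts of d (hypotheses `h261`, `hST`, `htri`, `hsymm`, `hrefl`, `hdnn`, as in all
siblings); (vii) the link to the carrier-level Props `B9.Thm39Printed` / `B9.Thm32Printed` / `B9.RWKernelSumYields`
(their `InvKernelBound`, `HasRWExpInv` are abstract `Prop`s over `Cfg`, not tied to operators on 𝔅 → ℝ; census
D-b09.2/D-b09.10–14) — this module discharges the implications at the kernel level and the dictionary is this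
docstring.  NOTHING of the paper's end-statement is asserted; value = kernel-checked bookkeeping of the printed
"= I − R (3.95)", "C₀(I − R)⁻¹ = Σ C₀Rⁿ (3.96) … convergent in the weighted supremum norm", "(2.83)" and "This theorem
implies Theorem 3.2", with the thresholds and constants the print leaves as O(·) made explicit — NOT summit progress.
Unit `b2b-balaban-b09-g5` (paper sub-cell B09, gen 5), SHARPEN pass 2 of node T06.9 (G-B9-07-THM39-KERNEL); cell rows
C-B9-21/C-B9-22, census D-b09.14.  v1.1 (`b2b-balaban-b09-g6`, docstring-only, declarations byte-identical): quotation
glyphs of this header per the cross-read G-pv06-6 — (3.48) now as printed («G′²(U)», «, y, y′∈𝔅 (y∈Λ_j, y′∈Λ_{j′}).»),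
and the (2.83) fragment opens with the printed «=» (the chain on p. 237 reads ≦ … ≦ … = … ≦).
-/

namespace Literature.MathematicalPhysics.QuantumFieldTheory.Balaban1983to89.B9Thm39Sum

open Literature.MathematicalPhysics.QuantumFieldTheory.Balaban1983to89
open Finset

/-! ## §1  (3.95): Q′G′²Q′\*C₀ = I − R as a ring identity -/

section Eq395

/-- The local inverse property behind (3.95) when the local problem is posed on the same space: from
(Q′G′²_□Q′\*)·C_□ = I (p. 409: *"C_□(U) = (Q′(U)G′²_□(U)Q′\*(U))⁻¹"*) and □̃·h_□ = h_□ (□̃ ⊇ supp h_□):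
h_□·(□̃·Q′G′²_□Q′\*)·C_□·h_□ = h_□·h_□. [cite: Balaban1985BackgroundPropagators, (3.87) p.409 + (3.95) p.411] -/
theorem hloc_of_inverse {A : Type*} [Ring A] {Hm Chi Cl Lloc : A} (hinv : Lloc * Cl = 1) (hχ : Chi * Hm = Hm) :
    Hm * (Chi * Lloc) * Cl * Hm = Hm * Hm := by
  calc Hm * (Chi * Lloc) * Cl * Hm = Hm * Chi * (Lloc * Cl) * Hm := by noncomm_ring
    _ = Hm * (Chi * Hm) := by rw [hinv, mul_one, mul_assoc]
    _ = Hm * Hm := by rw [hχ]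

/-- **(3.95)** (p. 411, *"We write it in the same way as in (2.82) [4]"*), an identity in any ring: with L = Q′G′²Q′\*,
L_□ = Q′G′²_□Q′\* (`Lloc`), the characteristic functions □̃ (`Chi`), the partition of unity h_□ (`Hm`, Σ_□ h²_□ = I: `hpu`)
and the local inverses C_□ (`Cl`, local inverse property `hloc`):
L·Σ_□ h_□C_□h_□ = I + Σ_□(1 − □̃)L·h_□C_□h_□ + Σ_□ □̃(L − L_□)·h_□C_□h_□ + Σ_□ (□̃L_□h_□ − h_□□̃L_□)·C_□h_□.
[cite: Balaban1985BackgroundPropagators, (3.95) p.411; Balaban1984PropagatorsII, (2.82) p.237] -/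
theorem eq395_sum {A : Type*} [Ring A] {ι : Type} [Fintype ι] (L : A) (Hm Chi Cl Lloc : ι → A)
    (hloc : ∀ i, Hm i * (Chi i * Lloc i) * Cl i * Hm i = Hm i * Hm i) (hpu : ∑ i, Hm i * Hm i = 1) :
    L * (∑ i, Hm i * Cl i * Hm i) =
      1 + ∑ i, (1 - Chi i) * L * (Hm i * Cl i * Hm i) + ∑ i, Chi i * (L - Lloc i) * (Hm i * Cl i * Hm i) +
        ∑ i, (Chi i * Lloc i * Hm i - Hm i * (Chi i * Lloc i)) * Cl i * Hm i := by
  have hterm : ∀ i, L * (Hm i * Cl i * Hm i) = Hm i * Hm i + ((1 - Chi i) * L * (Hm i * Cl i * Hm i) +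
      Chi i * (L - Lloc i) * (Hm i * Cl i * Hm i) + (Chi i * Lloc i * Hm i - Hm i * (Chi i * Lloc i)) * Cl i * Hm i) := by
    intro i
    have h : L * (Hm i * Cl i * Hm i) = Hm i * (Chi i * Lloc i) * Cl i * Hm i +
        ((1 - Chi i) * L * (Hm i * Cl i * Hm i) + Chi i * (L - Lloc i) * (Hm i * Cl i * Hm i) +
          (Chi i * Lloc i * Hm i - Hm i * (Chi i * Lloc i)) * Cl i * Hm i) := by
      noncomm_ring
    rw [hloc i] at h
    exact h
  rw [Finset.mul_sum, Finset.sum_congr rfl fun i _ => hterm i, Finset.sum_add_distrib, hpu, Finset.sum_add_distrib,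
    Finset.sum_add_distrib]
  abel

/-- (3.95) in the form "= I − R": with R := −(the three sums), L·C₀ = I − R. [cite: Balaban1985BackgroundPropagators, (3.95) p.411] -/
theorem eq395_oneSub {A : Type*} [Ring A] {ι : Type} [Fintype ι] (L : A) (Hm Chi Cl Lloc : ι → A)
    (hloc : ∀ i, Hm i * (Chi i * Lloc i) * Cl i * Hm i = Hm i * Hm i) (hpu : ∑ i, Hm i * Hm i = 1) :
    L * (∑ i, Hm i * Cl i * Hm i) =
      1 - -(∑ i, (1 - Chi i) * L * (Hm i * Cl i * Hm i) + ∑ i, Chi i * (L - Lloc i) * (Hm i * Cl i * Hm i) +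
        ∑ i, (Chi i * Lloc i * Hm i - Hm i * (Chi i * Lloc i)) * Cl i * Hm i) := by
  rw [eq395_sum L Hm Chi Cl Lloc hloc hpu, sub_neg_eq_add]
  abel

end Eq395

/-! ## Generic additions to the majorant bookkeeping (source-side localization, cut-offs) -/

section Generic

variable {G : B6.Geometry} {X : Type}

/-- **Sums of operators localized on the SOURCE side**: if every T_□ has the majorant χ_□(y′)κ(y, y′) (χ_□ ≥ 0 the
localization weight of the second variable — h_□ at the END of the term h_□C_□h_□) and Σ_□ χ_□(y′) ≦ N, then Σ_□ T_□ has
the majorant Nκ(y, y′) — the counting behind *"following from all the partial estimates of the type (2.83)"* ⇒ (2.85) of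
[4] p. 238. [cite: Balaban1984PropagatorsII, (2.83)–(2.85) p.238] -/
theorem hasMajorant_localSum_right (blk : X → G.Site) {ι : Type} [Fintype ι]
    (T : ι → Module.End ℝ (X → ℝ)) (χ : ι → G.Site → ℝ) (κ : G.Site → G.Site → ℝ) (N : ℝ)
    (hκ : ∀ a b, 0 ≤ κ a b) (hT : ∀ i, B6RandomWalk.HasMajorant blk (T i) (fun a b => χ i b * κ a b))
    (hN : ∀ b, ∑ i, χ i b ≤ N) :
    B6RandomWalk.HasMajorant blk (∑ i, T i) (fun a b => N * κ a b) := by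
  refine B6RandomWalk.hasMajorant_mono blk
    (B9Thm37Sum.hasMajorant_finsetSum blk Finset.univ T _ fun i _ => hT i) fun a b => ?_
  calc (∑ i, χ i b * κ a b) = (∑ i, χ i b) * κ a b := by rw [Finset.sum_mul]
    _ ≤ N * κ a b := mul_le_mul_of_nonneg_right (hN b) (hκ a b)

end Generic

/-! The two localization lemmas below carry characteristic functions of finite sets of sites; as gen-4's
`B9Thm37Sum.hasMajorant_sandwich_local` they are typed over B9's 𝔅 = `g.Site` read through `B9Thm34Ext.toB6`
(membership conditions elaborated at `g.Site`). -/

section Localization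

variable {g : B9.Geometry} [Fintype g.Site] [DecidableEq g.Site] {R : ℝ} {H : Prop} {X : Type}

/-- **Cut-off by a multiplication operator** (the factor 1 − □̃ *"at the beginning of the term"*, p. 411): if T has the
majorant K, |f| ≦ 1 and f vanishes on the blocks of the sites in S_χ, then f·T has the majorant 1_{y∉S_χ}K(y, y′).
[cite: Balaban1985BackgroundPropagators, (3.95) p.411] -/
theorem hasMajorant_mulOp_cut (blk : X → g.Site) {T : Module.End ℝ (X → ℝ)} {K : g.Site → g.Site → ℝ}
    (hT : B6RandomWalk.HasMajorant (g := B9Thm34Ext.toB6 g R H) blk T K) (f : X → ℝ) (hf : ∀ x, |f x| ≤ 1)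
    (Sχ : Finset g.Site) (hf0 : ∀ x, blk x ∈ Sχ → f x = 0) :
    B6RandomWalk.HasMajorant (g := B9Thm34Ext.toB6 g R H) blk (B9Thm37Sum.mulOp f * T)
      (fun (a b : g.Site) => (if a ∈ Sχ then (0 : ℝ) else 1) * K a b) := by
  intro y' μ B hμ x
  rw [Module.End.mul_apply, B9Thm37Sum.mulOp_apply, abs_mul]
  by_cases hx : blk x ∈ Sχ
  · rw [hf0 x hx, abs_zero, zero_mul]
    have e : (fun (a b : g.Site) => (if a ∈ Sχ then (0 : ℝ) else 1) * K a b) (blk x) y' = 0 := by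
      simp only [hx, if_true, zero_mul]
    rw [e, zero_mul]
  · have hb := hT y' μ B hμ x
    have e : (fun (a b : g.Site) => (if a ∈ Sχ then (0 : ℝ) else 1) * K a b) (blk x) y' = K (blk x) y' := by
      simp only [hx, if_false, one_mul]
    rw [e]
    calc |f x| * |T μ x| ≤ 1 * (K (blk x) y' * B) := mul_le_mul (hf x) hb (abs_nonneg _) zero_le_one
      _ = K (blk x) y' * B := one_mul _

/-- **Two-sided localization of h_□C_□h_□**: if C_□ has the majorant K, |h_□| ≦ 1 and supp h_□ only meets the blocks of
the sites in S_□, then h_□C_□h_□ has the majorant 1_{S_□}(y)1_{S_□}(y′)K(y, y′) — the h_□ *"at the end"* localizes the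
source variable too. [cite: Balaban1985BackgroundPropagators, (3.87) p.409 + p.411] -/
theorem hasMajorant_sandwich_local₂ (blk : X → g.Site) {Gop : Module.End ℝ (X → ℝ)} {K : g.Site → g.Site → ℝ}
    (hG : B6RandomWalk.HasMajorant (g := B9Thm34Ext.toB6 g R H) blk Gop K) (h : X → ℝ) (hh : ∀ x, |h x| ≤ 1)
    (S : Finset g.Site) (hS : ∀ x, h x ≠ 0 → blk x ∈ S) :
    B6RandomWalk.HasMajorant (g := B9Thm34Ext.toB6 g R H) blk (B9Thm37Sum.mulOp h * Gop * B9Thm37Sum.mulOp h)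
      (fun (a b : g.Site) => (if a ∈ S then (1 : ℝ) else 0) * (if b ∈ S then (1 : ℝ) else 0) * K a b) := by
  intro (y' : g.Site) μ B hμ x
  by_cases hy' : y' ∈ S
  · by_cases hx : blk x ∈ S
    · have hb := B9Thm37Sum.hasMajorant_sandwich (G := B9Thm34Ext.toB6 g R H) blk hG h hh y' μ B hμ x
      have e : (fun (a b : g.Site) => (if a ∈ S then (1 : ℝ) else 0) * (if b ∈ S then (1 : ℝ) else 0) * K a b)
          (blk x) y' = K (blk x) y' := by
        simp only [hx, hy', if_true, one_mul]
      rw [e]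
      exact hb
    · have h0 : h x = 0 := by
        by_contra hne
        exact hx (hS x hne)
      rw [B9Thm37Sum.sandwich_apply_eq_zero (Gop := Gop) h μ x h0, abs_zero]
      have e : (fun (a b : g.Site) => (if a ∈ S then (1 : ℝ) else 0) * (if b ∈ S then (1 : ℝ) else 0) * K a b)
          (blk x) y' = 0 := by
        simp only [hx, if_false, zero_mul]
      rw [e, zero_mul]
  · -- the source block y′ does not meet supp h_□: h_□μ = 0
    have hμ0 : B9Thm37Sum.mulOp h μ = 0 := by
      funext x'
      rw [B9Thm37Sum.mulOp_apply, Pi.zero_apply]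
      by_cases hx' : blk x' = y'
      · have : h x' = 0 := by
          by_contra hne
          exact hy' (hx' ▸ hS x' hne)
        rw [this, zero_mul]
      · rw [hμ.off x' hx', mul_zero]
    rw [Module.End.mul_apply, Module.End.mul_apply, hμ0, map_zero, B9Thm37Sum.mulOp_apply, Pi.zero_apply, mul_zero,
      abs_zero]
    have e : (fun (a b : g.Site) => (if a ∈ S then (1 : ℝ) else 0) * (if b ∈ S then (1 : ℝ) else 0) * K a b)
        (blk x) y' = 0 := by
      simp only [hy', if_false, mul_zero, zero_mul]
    rw [e, zero_mul]

end Localization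

/-! ## §2  (3.96): C₀(I − R)⁻¹ = Σ C₀Rⁿ is the inverse and satisfies (3.48), smallness and constants explicit -/

section Inversion

variable {g : B9.Geometry} [Fintype g.Site] [DecidableEq g.Site] {R : ℝ} {H : Prop}

/-- **C₀ = Σ_□ h_□C_□h_□ obeys (3.48), localized** (entry form, pairing weight (L^{j′}η)^d absorbed): if every C_□ has the
(3.48)-majorant A·P(y)e^{−r·d(y,y′)} (P(y) = (L^jη)^{−4}; *"satisfy all the inequalities of Theorems 3.1–3.3"*, p. 409),
|h_□| ≦ 1, supp h_□ ∩ 𝔅 ⊂ S_□ and every site lies in at most N of the S_□, then C₀ has the majorant N·A·P(y)e^{−r·d(y,y′)}.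
[cite: Balaban1985BackgroundPropagators, (3.87) p.409 + Thm 3.2 (3.48) p.398] -/
theorem c0_majorant (A r N : ℝ) (P : g.Site → ℝ) {ι : Type} [Fintype ι] (S : ι → Finset g.Site)
    (h : ι → g.Site → ℝ) (Cl : ι → Module.End ℝ (g.Site → ℝ)) (hA : 0 ≤ A) (hP : ∀ y, 0 ≤ P y)
    (hh : ∀ i y, |h i y| ≤ 1) (hS : ∀ i y, h i y ≠ 0 → y ∈ S i)
    (hC : ∀ i, B6RandomWalk.HasMajorant (g := B9Thm34Ext.toB6 g R H) (fun x : g.Site => x) (Cl i)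
      (fun a b => A * P a * Real.exp (-(r * g.dist a b))))
    (hcnt : ∀ a : g.Site, (∑ i, if a ∈ S i then (1 : ℝ) else 0) ≤ N) :
    B6RandomWalk.HasMajorant (g := B9Thm34Ext.toB6 g R H) (fun x : g.Site => x)
      (∑ i, B9Thm37Sum.mulOp (h i) * Cl i * B9Thm37Sum.mulOp (h i))
      (fun a b => N * (A * P a * Real.exp (-(r * g.dist a b)))) := by
  refine B9Thm37Sum.hasMajorant_localSum (G := B9Thm34Ext.toB6 g R H) (fun x : g.Site => x) _
    (fun i (a : g.Site) => if a ∈ S i then (1 : ℝ) else 0) _ N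
    (fun a b => mul_nonneg (mul_nonneg hA (hP a)) (Real.exp_nonneg _)) (fun i => ?_) hcnt
  refine B6RandomWalk.hasMajorant_mono (g := B9Thm34Ext.toB6 g R H) _
    (B9Thm37Sum.hasMajorant_sandwich_local (R := R) (H := H) (fun x : g.Site => x) (hC i) (h i) (hh i) (S i) (hS i))
    fun a b => le_of_eq ?_
  split_ifs <;> simp

/-- *"the operator R is small"* ⇒ I − R is invertible: if R has the entry majorant θe^{−r·d(y,y′)} ((2.85)-shape),
(2.61) of [4] holds at (r, α′), α′ ≦ 1, and θc₁(r, α′) < 1, then I − R is invertible (row sums ≦ θc₁ < 1, maximum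
principle on the finite set 𝔅, finite dimension: `B9Thm34Inv.isUnit_one_add_of_rowSum`).
[cite: Balaban1985BackgroundPropagators, (3.96) p.411; Balaban1984PropagatorsII, (2.85)–(2.86) p.238] -/
theorem isUnit_one_sub_of_majorant (d : ℕ) (r α' θ : ℝ) (hθ : 0 ≤ θ) (hα' : α' ≤ 1) (hr : 0 ≤ r)
    (hdnn : ∀ a b : g.Site, 0 ≤ g.dist a b) (h261 : B6RandomWalk.Ineq261 d (B9Thm34Ext.toB6 g R H) r α')
    (hsmall : θ * B6.c1 d r α' < 1) {Rop : Module.End ℝ (g.Site → ℝ)}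
    (hR : B6RandomWalk.HasMajorant (g := B9Thm34Ext.toB6 g R H) (fun x : g.Site => x) Rop
      (fun a b => θ * Real.exp (-(r * g.dist a b)))) :
    IsUnit (1 - Rop) := by
  have hneg : B6RandomWalk.HasMajorant (g := B9Thm34Ext.toB6 g R H) (fun x : g.Site => x) (-Rop)
      (fun a b => θ * Real.exp (-(r * g.dist a b))) := by
    rw [B9Thm34Inv.hasMajorant_id_iff] at hR ⊢
    intro y y'
    rw [B9Thm34Inv.entry_neg, abs_neg]
    exact hR y y'
  have h := B9Thm34Inv.isUnit_one_add_of_rowSum (-Rop) _ hsmall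
    (B9Thm34Inv.rowSum_le_of_majorant (R := R) (H := H) d r α' θ hθ hα' hr hdnn h261 hneg)
  rwa [← sub_eq_add_neg] at h

/-- **(3.96), with the smallness and the constants EXPLICIT** (entry form).  Data: L = Q′G′²Q′\*, C₀, R with L·C₀ = I − R
((3.95), `h395`).  Hypotheses of the printed shape: `hC0` = the (3.48)-majorant A·P(y)e^{−r·d(y,y′)} of C₀
(`c0_majorant`); `hR` = the (2.85)-shape majorant θe^{−r·d(y,y′)} of R (*"By the same estimates as in [4], especially
(2.83)–(2.85), we can see that the operator R is small"* — by reference, a hypothesis here); Lemma 2.1 of [4] (2.61) at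
(r, α′) with α′ ≦ 1, the metric facts (2.54), d(y,y) = 0, d ≧ 0; and the smallness θc₁(r, α′) < 1.  Conclusion: there is
T (= C₀(I − R)⁻¹) with T·L = I = L·T (a two-sided inverse: the space of functions on the finite set 𝔅 is
finite-dimensional), T·(I − R) = C₀, the fixed-point form T = C₀ + T·R of the Neumann series Σ C₀Rⁿ, and the majorant
A·c₁(r,α′)(1 − θc₁(r,α′))⁻¹P(y)e^{−(1−α′)r·d(y,y′)} — *"The series is convergent in the weighted supremum norm on 𝔅
appearing in the inequality (3.48)"*, by [4] (2.64)–(2.66) (pv08's `majorant_of_fixedPoint_266`).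
[cite: Balaban1985BackgroundPropagators, (3.95)–(3.96) p.411; Balaban1984PropagatorsII, (2.66) p.234 + Prop. 2.3 p.238] -/
theorem inverse_of_395 (d : ℕ) (r α' θ A : ℝ) (P : g.Site → ℝ)
    (hA : 0 ≤ A) (hP : ∀ y, 0 ≤ P y) (hθ : 0 ≤ θ) (hr : 0 ≤ r) (hα' : α' ≤ 1)
    (htri : B6RandomWalk.Triangle254 (B9Thm34Ext.toB6 g R H)) (hrefl : ∀ y : g.Site, g.dist y y = 0)
    (hdnn : ∀ a b : g.Site, 0 ≤ g.dist a b) (h261 : B6RandomWalk.Ineq261 d (B9Thm34Ext.toB6 g R H) r α')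
    (hsmall : θ * B6.c1 d r α' < 1)
    {L C0 Rop : Module.End ℝ (g.Site → ℝ)} (h395 : L * C0 = 1 - Rop)
    (hC0 : B6RandomWalk.HasMajorant (g := B9Thm34Ext.toB6 g R H) (fun x : g.Site => x) C0
      (fun a b => A * P a * Real.exp (-(r * g.dist a b))))
    (hR : B6RandomWalk.HasMajorant (g := B9Thm34Ext.toB6 g R H) (fun x : g.Site => x) Rop
      (fun a b => θ * Real.exp (-(r * g.dist a b)))) :
    ∃ T : Module.End ℝ (g.Site → ℝ), T * L = 1 ∧ L * T = 1 ∧ T * (1 - Rop) = C0 ∧ T = C0 + T * Rop ∧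
      B6RandomWalk.HasMajorant (g := B9Thm34Ext.toB6 g R H) (fun x : g.Site => x) T
        (fun a b => A * B6.c1 d r α' * (1 - θ * B6.c1 d r α')⁻¹ * P a *
          Real.exp (-((1 - α') * r * g.dist a b))) := by
  obtain ⟨u, hu⟩ := isUnit_one_sub_of_majorant (R := R) (H := H) d r α' θ hθ hα' hr hdnn h261 hsmall hR
  have hLT : L * (C0 * ↑u⁻¹) = 1 := by
    rw [← mul_assoc, h395, ← hu, Units.mul_inv]
  have hTL : C0 * ↑u⁻¹ * L = 1 := mul_eq_one_symm hLT
  have hTR : C0 * ↑u⁻¹ * (1 - Rop) = C0 := by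
    rw [mul_assoc, ← hu, Units.inv_mul, mul_one]
  have hfix : C0 * ↑u⁻¹ = C0 + C0 * ↑u⁻¹ * Rop := by
    have h := hTR
    rw [mul_sub, mul_one, sub_eq_iff_eq_add] at h
    exact h
  refine ⟨C0 * ↑u⁻¹, hTL, hLT, hTR, hfix, ?_⟩
  have hαδ : 0 ≤ (1 - α') * r := mul_nonneg (sub_nonneg.mpr hα') hr
  have h263 := B9Thm34Ext.h263_of_h261 g R H d r α' htri hr hα' h261
  exact B6RandomWalk.majorant_of_fixedPoint_266 (g := B9Thm34Ext.toB6 g R H) (fun x : g.Site => x) d r α' θ A P hA hP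
    hθ hαδ htri hrefl hdnn h261 h263 hsmall hC0 hR hfix

/-- **(3.96) ⇒ (3.48) for (Q′G′²Q′\*)⁻¹ in the printed kernel notation, threshold and constants explicit.**  With the
kernels T(y, y′) w.r.t. the pairing weight (L^{j′}η)^d (`B9Thm34Inv.ker (vol g d)`): if L·C₀ = I − R, |C₀(y, y′)| ≦
A(L^jη)^{−4}(L^{j′}η)^{−d}e^{−r·d(y,y′)} ((3.48) for C₀, `hC0`), |R(y, y′)| ≦ θ₀M^{−1}(L^{j′}η)^{−d}e^{−r·d(y,y′)} ((2.85) of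
[4]: `hRk`), (2.61) of [4] at (r, α′) with α′ ≦ 1, and **M ≧ 2θ₀c₁(r, α′)** (*"for M sufficiently large"*, located),
then L = Q′G′²Q′\* has a two-sided inverse T = C₀(I − R)⁻¹ with |T(y, y′)| ≦ 2A·c₁(r, α′)(L^jη)^{−4}(L^{j′}η)^{−d}
e^{−(1−α′)r·d(y,y′)} — (3.48) with **B₀ ↦ 2Ac₁(r, α′), δ₀ ↦ (1 − α′)r** ([4] (2.87): rate ½δ₁).
[cite: Balaban1985BackgroundPropagators, (3.96) p.411 + Thm 3.2 (3.48) p.398; Balaban1984PropagatorsII, (2.85)–(2.87) p.238] -/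
theorem inverse_kernel_348_of_395 (d : ℕ) (r α' θ₀ A : ℝ)
    (hr : 0 ≤ r) (hα' : α' ≤ 1) (hθ₀ : 0 ≤ θ₀) (hA : 0 ≤ A) (hM : 0 < g.M)
    (hMbig : 2 * θ₀ * B6.c1 d r α' ≤ g.M)
    (htri : B6RandomWalk.Triangle254 (B9Thm34Ext.toB6 g R H)) (hrefl : ∀ y : g.Site, g.dist y y = 0)
    (hdnn : ∀ a b : g.Site, 0 ≤ g.dist a b) (hlen : ∀ y : g.Site, 0 < g.len y)
    (h261 : B6RandomWalk.Ineq261 d (B9Thm34Ext.toB6 g R H) r α')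
    {L C0 Rop : Module.End ℝ (g.Site → ℝ)} (h395 : L * C0 = 1 - Rop)
    (hC0 : ∀ y y' : g.Site, |B9Thm34Inv.ker (B9Thm34Inv.vol g d) C0 y y'| ≤
      A * g.len y ^ (-(4 : ℝ)) * g.len y' ^ (-(d : ℝ)) * Real.exp (-(r * g.dist y y')))
    (hRk : ∀ y y' : g.Site, |B9Thm34Inv.ker (B9Thm34Inv.vol g d) Rop y y'| ≤
      θ₀ * g.M⁻¹ * g.len y' ^ (-(d : ℝ)) * Real.exp (-(r * g.dist y y'))) :
    ∃ T : Module.End ℝ (g.Site → ℝ), T * L = 1 ∧ L * T = 1 ∧ T * (1 - Rop) = C0 ∧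
      ∀ y y' : g.Site, |B9Thm34Inv.ker (B9Thm34Inv.vol g d) T y y'| ≤
        2 * A * B6.c1 d r α' * g.len y ^ (-(4 : ℝ)) * g.len y' ^ (-(d : ℝ)) *
          Real.exp (-((1 - α') * r * g.dist y y')) := by
  set P : g.Site → ℝ := fun y => g.len y ^ (-(4 : ℝ)) with hPdef
  set c : ℝ := B6.c1 d r α' with hcdef
  set θ : ℝ := θ₀ * g.M⁻¹ with hθdef
  have hP : ∀ y, 0 < P y := fun y => Real.rpow_pos_of_pos (hlen y) _
  have hvol := B9Thm34Inv.vol_pos d hlen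
  have hc : 0 ≤ c := B6RandomWalk.c1_nonneg d r α'
  have hθ : 0 ≤ θ := mul_nonneg hθ₀ (inv_nonneg.mpr hM.le)
  -- the located smallness: θc ≤ 1/2 from M ≥ 2θ₀c
  have hθc : θ * c ≤ 1 / 2 := by
    rw [hθdef]
    have h1 : θ₀ * c ≤ g.M / 2 := by nlinarith
    calc θ₀ * g.M⁻¹ * c = θ₀ * c / g.M := by ring
      _ ≤ g.M / 2 / g.M := div_le_div_of_nonneg_right h1 hM.le
      _ = 1 / 2 := by field_simp
  have hsmall : θ * c < 1 := by linarith
  -- the hypotheses in entry form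
  have hC0e : B6RandomWalk.HasMajorant (g := B9Thm34Ext.toB6 g R H) (fun x : g.Site => x) C0
      (fun a b => A * P a * Real.exp (-(r * g.dist a b))) := by
    refine (B9Thm34Inv.hasMajorant_id_iff _ _).mpr fun y y' =>
      (B9Thm34Inv.ker_le_iff (B9Thm34Inv.vol g d) (hvol y') C0 y _).mp ?_
    refine (hC0 y y').trans (le_of_eq ?_)
    rw [B9Thm34Inv.vol_inv d hlen y']
    simp only [hPdef]
    ring
  have hRe : B6RandomWalk.HasMajorant (g := B9Thm34Ext.toB6 g R H) (fun x : g.Site => x) Rop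
      (fun a b => θ * Real.exp (-(r * g.dist a b))) := by
    refine (B9Thm34Inv.hasMajorant_id_iff _ _).mpr fun y y' =>
      (B9Thm34Inv.ker_le_iff (B9Thm34Inv.vol g d) (hvol y') Rop y _).mp ?_
    refine (hRk y y').trans (le_of_eq ?_)
    rw [B9Thm34Inv.vol_inv d hlen y', hθdef]
    ring
  obtain ⟨T, hTL, hLT, hTR, -, hmaj⟩ := inverse_of_395 (R := R) (H := H) d r α' θ A P hA (fun y => (hP y).le) hθ hr
    hα' htri hrefl hdnn h261 hsmall h395 hC0e hRe
  refine ⟨T, hTL, hLT, hTR, fun y y' => ?_⟩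
  have hent := (B9Thm34Inv.hasMajorant_id_iff _ _).mp hmaj y y'
  have hinv : (1 - θ * c)⁻¹ ≤ 2 := by
    rw [inv_le_comm₀ (by linarith) (by norm_num : (0 : ℝ) < 2)]
    linarith
  have hconst : A * c * (1 - θ * c)⁻¹ ≤ 2 * A * c := by
    calc A * c * (1 - θ * c)⁻¹ ≤ A * c * 2 := mul_le_mul_of_nonneg_left hinv (mul_nonneg hA hc)
      _ = 2 * A * c := by ring
  have hb : |B9Thm34Inv.entry T y y'| ≤ 2 * A * c * P y * Real.exp (-((1 - α') * r * g.dist y y')) := by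
    refine hent.trans ?_
    have hrest : 0 ≤ P y * Real.exp (-((1 - α') * r * g.dist y y')) := mul_nonneg (hP y).le (Real.exp_nonneg _)
    calc A * c * (1 - θ * c)⁻¹ * P y * Real.exp (-((1 - α') * r * g.dist y y'))
        = A * c * (1 - θ * c)⁻¹ * (P y * Real.exp (-((1 - α') * r * g.dist y y'))) := by ring
      _ ≤ 2 * A * c * (P y * Real.exp (-((1 - α') * r * g.dist y y'))) := mul_le_mul_of_nonneg_right hconst hrest
      _ = _ := by ring
  have hk := (B9Thm34Inv.ker_le_iff (B9Thm34Inv.vol g d) (hvol y') T y _).mpr hb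
  refine hk.trans (le_of_eq ?_)
  rw [B9Thm34Inv.vol_inv d hlen y', hPdef]
  simp only
  ring

end Inversion

/-! ## §2b  The (2.83)-estimate of [4] for the first sum of (3.95), kernel-checked -/

section FirstSum

variable {g : B9.Geometry} [Fintype g.Site] [DecidableEq g.Site] {R : ℝ} {H : Prop}

/-- **[4] (2.83) for the □-term (1 − □̃)Q′G′²Q′\*h_□C_□h_□ of the first sum of (3.95), constants explicit** (entry form,
pairing weight absorbed; P(y) = (L^jη)^{−4}, any P > 0).  Hypotheses of the printed shape, NAMED: `hL` = the upper bound
for the kernel of L = Q′G′²Q′\*, |L(y, y″)|(L^{j″}η)^d ≦ κ(L^jη)⁴e^{−a_Lδ₀d(y,y″)} ((2.83) line 1: *"(L^{j′}η)^d(Q′G′²Q′\*)(y, y″)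
… O(1)(L^jη)⁴Σ_{y″∈supp h_□′}e^{−½δ₀d(y,y″)}"*, a_L = ½); `hT` = (3.48) for C_□ two-sided-localized to S_□ ⊃ supp h_□ ∩ 𝔅
(`hasMajorant_sandwich_local₂`), rate bδ₀ (= δ₁ of [4]); `hχ1`, `hχ0` = the cut-off 1 − □̃ (|·| ≦ 1, = 0 on S_χ = □̃ ∩ 𝔅);
`hsep` = *"restrict a kernel of the term to points separated at least by a distance ML^jη"*: d(y, y″) ≧ D_sep for
y ∉ S_χ, y″ ∈ S_□; `hST` = the scale transfer of the p. 398 remark at exponent α_st with constant C ([4] (2.60); kills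
the L^{4(j−j″)} of (2.83)); `h261` = (2.61) of [4] at the exponent b − ρ; the split a_L ≧ α_st + a_sep + ρ with a_sep, ρ ≧ 0;
(2.54) and the symmetry of d.  Conclusion: the term has the majorant 1_{y∉S_χ}1_{S_□}(y′)·κB₀C·c₁(δ₀, b−ρ)·
e^{−a_sepδ₀D_sep}·e^{−ρδ₀d(y,y′)} — (2.83)'s *"O(1)e^{−⅛δ₀M}e^{−δ₁d(y,y′)}(L^{j′}η)^{−d}"* with O(1) = κB₀Cc₁ and the
exponents named.  Route, term by term in the y″-sum ([4] (2.52)): e^{−a_Lδ₀d(y,y″)} ≦ e^{−α_stδ₀d}e^{−a_sepδ₀d}e^{−ρδ₀d};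
the first factor carries (L^jη)⁴(L^{j″}η)^{−4} (scale transfer), the second is ≦ e^{−a_sepδ₀D_sep} (separation), the third
joins e^{−bδ₀d(y″,y′)}: ρδ₀d(y,y″) + bδ₀d(y″,y′) ≧ ρδ₀d(y,y′) + (b−ρ)δ₀d(y′,y″) (triangle inequality, symmetry), and the
y″-sum of e^{−(b−ρ)δ₀d(y′,y″)} is (2.61). [cite: Balaban1985BackgroundPropagators, (3.95) p.411; Balaban1984PropagatorsII, (2.83) p.238] -/
theorem firstSum_term_majorant (d : ℕ) (δ₀ aL αst asep ρ b κ B₀ C Dsep : ℝ) (P : g.Site → ℝ)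
    (Sχ S : Finset g.Site) (χc : g.Site → ℝ)
    (hκ : 0 ≤ κ) (hB₀ : 0 ≤ B₀) (hC : 0 ≤ C) (hP : ∀ y, 0 < P y) (hδ₀ : 0 ≤ δ₀)
    (hasep : 0 ≤ asep) (hρ : 0 ≤ ρ) (hsplit : αst + asep + ρ ≤ aL)
    (htri : B6RandomWalk.Triangle254 (B9Thm34Ext.toB6 g R H)) (hsymm : ∀ a b : g.Site, g.dist a b = g.dist b a)
    (hdnn : ∀ a b : g.Site, 0 ≤ g.dist a b)
    (hST : B9Ineq347.ScaleTransfer g δ₀ αst C P)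
    (h261 : B6RandomWalk.Ineq261 d (B9Thm34Ext.toB6 g R H) δ₀ (b - ρ))
    (hχ1 : ∀ y, |χc y| ≤ 1) (hχ0 : ∀ y, y ∈ Sχ → χc y = 0)
    (hsep : ∀ y, y ∉ Sχ → ∀ y'' ∈ S, Dsep ≤ g.dist y y'')
    {Lop T : Module.End ℝ (g.Site → ℝ)}
    (hL : B6RandomWalk.HasMajorant (g := B9Thm34Ext.toB6 g R H) (fun x : g.Site => x) Lop
      (fun (a y'' : g.Site) => κ * (P a)⁻¹ * Real.exp (-(aL * δ₀ * g.dist a y''))))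
    (hT : B6RandomWalk.HasMajorant (g := B9Thm34Ext.toB6 g R H) (fun x : g.Site => x) T
      (fun (y'' b' : g.Site) => (if y'' ∈ S then (1 : ℝ) else 0) * (if b' ∈ S then (1 : ℝ) else 0) *
        (B₀ * P y'' * Real.exp (-(b * δ₀ * g.dist y'' b'))))) :
    B6RandomWalk.HasMajorant (g := B9Thm34Ext.toB6 g R H) (fun x : g.Site => x) (B9Thm37Sum.mulOp χc * Lop * T)
      (fun (a b' : g.Site) => (if a ∈ Sχ then (0 : ℝ) else 1) * (if b' ∈ S then (1 : ℝ) else 0) *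
        (κ * B₀ * C * B6.c1 d δ₀ (b - ρ) * Real.exp (-(asep * δ₀ * Dsep))) * Real.exp (-(ρ * δ₀ * g.dist a b'))) := by
  -- the composed kernel of L·(h_□C_□h_□) ([4] (2.52))
  have hK₂ : ∀ y'' b' : g.Site, 0 ≤ (if y'' ∈ S then (1 : ℝ) else 0) * (if b' ∈ S then (1 : ℝ) else 0) *
      (B₀ * P y'' * Real.exp (-(b * δ₀ * g.dist y'' b'))) := fun y'' b' =>
    mul_nonneg (mul_nonneg (by split_ifs <;> norm_num) (by split_ifs <;> norm_num))
      (mul_nonneg (mul_nonneg hB₀ (hP y'').le) (Real.exp_nonneg _))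
  have hLT := B6RandomWalk.hasMajorant_mul (g := B9Thm34Ext.toB6 g R H) _ hL hT hK₂
  -- the cut-off 1 − □̃ in front
  have hcut := hasMajorant_mulOp_cut (R := R) (H := H) (fun x : g.Site => x) hLT χc hχ1 Sχ
    (fun x hx => hχ0 x hx)
  rw [mul_assoc]
  refine B6RandomWalk.hasMajorant_mono (g := B9Thm34Ext.toB6 g R H) _ hcut fun (a b' : g.Site) => ?_
  by_cases ha : a ∈ Sχ
  · simp [ha]
  simp only [ha, if_false, one_mul]
  -- now a ∉ S_χ: bound the y″-sum
  have hcoefρ : 0 ≤ ρ * δ₀ := mul_nonneg hρ hδ₀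
  have hind : 0 ≤ (if b' ∈ S then (1 : ℝ) else 0) := by split_ifs <;> norm_num
  have hterm : ∀ y'' : g.Site,
      κ * (P a)⁻¹ * Real.exp (-(aL * δ₀ * g.dist a y'')) *
          ((if y'' ∈ S then (1 : ℝ) else 0) * (if b' ∈ S then (1 : ℝ) else 0) *
            (B₀ * P y'' * Real.exp (-(b * δ₀ * g.dist y'' b')))) ≤
        (if b' ∈ S then (1 : ℝ) else 0) * (κ * B₀ * C * Real.exp (-(asep * δ₀ * Dsep))) *
          Real.exp (-(ρ * δ₀ * g.dist a b')) * Real.exp (-((b - ρ) * δ₀ * g.dist b' y'')) := by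
    intro y''
    by_cases hy'' : y'' ∈ S
    · simp only [hy'', if_true, one_mul]
      -- (i) split of the exponential of L
      have hsplitexp : Real.exp (-(aL * δ₀ * g.dist a y'')) ≤
          Real.exp (-(αst * δ₀ * g.dist a y'')) * Real.exp (-(asep * δ₀ * g.dist a y'')) *
            Real.exp (-(ρ * δ₀ * g.dist a y'')) := by
        rw [← Real.exp_add, ← Real.exp_add]
        refine Real.exp_le_exp.mpr ?_
        have h1 := mul_le_mul_of_nonneg_right hsplit (mul_nonneg hδ₀ (hdnn a y''))
        nlinarith [h1]
      -- (ii) scale transfer (L^jη)⁴e^{−α_st δ₀ d(y,y″)}(L^{j″}η)^{−4} ≦ C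
      have hst : (P a)⁻¹ * (Real.exp (-(αst * δ₀ * g.dist a y'')) * P y'') ≤ C := by
        have h1 := hST a y''
        calc (P a)⁻¹ * (Real.exp (-(αst * δ₀ * g.dist a y'')) * P y'') ≤ (P a)⁻¹ * (C * P a) :=
              mul_le_mul_of_nonneg_left h1 (inv_nonneg.mpr (hP a).le)
          _ = C := by rw [mul_comm C, ← mul_assoc, inv_mul_cancel₀ (hP a).ne', one_mul]
      -- (iii) separation
      have hsepexp : Real.exp (-(asep * δ₀ * g.dist a y'')) ≤ Real.exp (-(asep * δ₀ * Dsep)) := by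
        refine Real.exp_le_exp.mpr ?_
        have h1 := mul_le_mul_of_nonneg_left (hsep a ha y'' hy'') (mul_nonneg hasep hδ₀)
        linarith
      -- (iv) triangle inequality and symmetry
      have htri' : Real.exp (-(ρ * δ₀ * g.dist a y'')) * Real.exp (-(b * δ₀ * g.dist y'' b')) ≤
          Real.exp (-(ρ * δ₀ * g.dist a b')) * Real.exp (-((b - ρ) * δ₀ * g.dist b' y'')) := by
        rw [← Real.exp_add, ← Real.exp_add]
        refine Real.exp_le_exp.mpr ?_
        have h0 : g.dist a b' ≤ g.dist a y'' + g.dist y'' b' := htri a y'' b'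
        have h1 := mul_le_mul_of_nonneg_left h0 hcoefρ
        rw [hsymm b' y'']
        nlinarith [h1]
      have hrest : 0 ≤ κ * (P a)⁻¹ * ((if b' ∈ S then (1 : ℝ) else 0) *
          (B₀ * P y'' * Real.exp (-(b * δ₀ * g.dist y'' b')))) :=
        mul_nonneg (mul_nonneg hκ (inv_nonneg.mpr (hP a).le))
          (mul_nonneg hind (mul_nonneg (mul_nonneg hB₀ (hP y'').le) (Real.exp_nonneg _)))
      have hkab : 0 ≤ (if b' ∈ S then (1 : ℝ) else 0) * κ * B₀ := mul_nonneg (mul_nonneg hind hκ) hB₀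
      calc κ * (P a)⁻¹ * Real.exp (-(aL * δ₀ * g.dist a y'')) *
            ((if b' ∈ S then (1 : ℝ) else 0) * (B₀ * P y'' * Real.exp (-(b * δ₀ * g.dist y'' b'))))
          = Real.exp (-(aL * δ₀ * g.dist a y'')) * (κ * (P a)⁻¹ *
              ((if b' ∈ S then (1 : ℝ) else 0) * (B₀ * P y'' * Real.exp (-(b * δ₀ * g.dist y'' b'))))) := by ring
        _ ≤ Real.exp (-(αst * δ₀ * g.dist a y'')) * Real.exp (-(asep * δ₀ * g.dist a y'')) *
              Real.exp (-(ρ * δ₀ * g.dist a y'')) * (κ * (P a)⁻¹ *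
              ((if b' ∈ S then (1 : ℝ) else 0) * (B₀ * P y'' * Real.exp (-(b * δ₀ * g.dist y'' b'))))) :=
            mul_le_mul_of_nonneg_right hsplitexp hrest
        _ = (if b' ∈ S then (1 : ℝ) else 0) * κ * B₀ * ((P a)⁻¹ * (Real.exp (-(αst * δ₀ * g.dist a y'')) * P y'')) *
              Real.exp (-(asep * δ₀ * g.dist a y'')) *
              (Real.exp (-(ρ * δ₀ * g.dist a y'')) * Real.exp (-(b * δ₀ * g.dist y'' b'))) := by ring
        _ ≤ (if b' ∈ S then (1 : ℝ) else 0) * κ * B₀ * C * Real.exp (-(asep * δ₀ * Dsep)) *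
              (Real.exp (-(ρ * δ₀ * g.dist a b')) * Real.exp (-((b - ρ) * δ₀ * g.dist b' y''))) := by
            refine mul_le_mul ?_ htri' (mul_nonneg (Real.exp_nonneg _) (Real.exp_nonneg _)) ?_
            · exact mul_le_mul (mul_le_mul_of_nonneg_left hst hkab) hsepexp (Real.exp_nonneg _)
                (mul_nonneg hkab hC)
            · exact mul_nonneg (mul_nonneg hkab hC) (Real.exp_nonneg _)
        _ = _ := by ring
    · simp only [hy'', if_false, zero_mul, mul_zero]
      exact mul_nonneg (mul_nonneg (mul_nonneg hind
        (mul_nonneg (mul_nonneg (mul_nonneg hκ hB₀) hC) (Real.exp_nonneg _))) (Real.exp_nonneg _)) (Real.exp_nonneg _)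
  have hpref : 0 ≤ (if b' ∈ S then (1 : ℝ) else 0) * (κ * B₀ * C * Real.exp (-(asep * δ₀ * Dsep))) *
      Real.exp (-(ρ * δ₀ * g.dist a b')) :=
    mul_nonneg (mul_nonneg hind (mul_nonneg (mul_nonneg (mul_nonneg hκ hB₀) hC) (Real.exp_nonneg _)))
      (Real.exp_nonneg _)
  calc ∑ y'' : g.Site, κ * (P a)⁻¹ * Real.exp (-(aL * δ₀ * g.dist a y'')) *
          ((if y'' ∈ S then (1 : ℝ) else 0) * (if b' ∈ S then (1 : ℝ) else 0) *
            (B₀ * P y'' * Real.exp (-(b * δ₀ * g.dist y'' b'))))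
      ≤ ∑ y'' : g.Site, (if b' ∈ S then (1 : ℝ) else 0) * (κ * B₀ * C * Real.exp (-(asep * δ₀ * Dsep))) *
          Real.exp (-(ρ * δ₀ * g.dist a b')) * Real.exp (-((b - ρ) * δ₀ * g.dist b' y'')) :=
        Finset.sum_le_sum fun y'' _ => hterm y''
    _ = (if b' ∈ S then (1 : ℝ) else 0) * (κ * B₀ * C * Real.exp (-(asep * δ₀ * Dsep))) *
          Real.exp (-(ρ * δ₀ * g.dist a b')) * ∑ y'' : g.Site, Real.exp (-((b - ρ) * δ₀ * g.dist b' y'')) := by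
        rw [Finset.mul_sum]
    _ ≤ (if b' ∈ S then (1 : ℝ) else 0) * (κ * B₀ * C * Real.exp (-(asep * δ₀ * Dsep))) *
          Real.exp (-(ρ * δ₀ * g.dist a b')) * B6.c1 d δ₀ (b - ρ) := mul_le_mul_of_nonneg_left (h261 b') hpref
    _ = _ := by ring

/-- **(2.83) ⇒ (2.85) of [4] for the first sum of (3.95), summed over □ with its O(M⁻¹) explicit.**  If every □-term
(1 − □̃)L·h_□C_□h_□ has the majorant 1_{y∉S_χ(□)}1_{S_□}(y′)·Θ·e^{−ρδ₀d(y,y′)} (`firstSum_term_majorant`, uniform Θ) and every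
site of 𝔅 lies in at most N of the S_□ (the h_□ *"at the end"*), then the first sum has the majorant N·Θ·e^{−ρδ₀d(y,y′)}
— (2.85)-shape, *"following from all the partial estimates of the type (2.83)"* ([4] p. 238).
[cite: Balaban1985BackgroundPropagators, (3.95) p.411; Balaban1984PropagatorsII, (2.83)–(2.85) p.238] -/
theorem firstSum_majorant (ρ δ₀ Θ N : ℝ) {ι : Type} [Fintype ι] (Sχ S : ι → Finset g.Site)
    (Tm : ι → Module.End ℝ (g.Site → ℝ)) (hΘ : 0 ≤ Θ)
    (hTm : ∀ i, B6RandomWalk.HasMajorant (g := B9Thm34Ext.toB6 g R H) (fun x : g.Site => x) (Tm i)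
      (fun (a b' : g.Site) => (if a ∈ Sχ i then (0 : ℝ) else 1) * (if b' ∈ S i then (1 : ℝ) else 0) * Θ *
        Real.exp (-(ρ * δ₀ * g.dist a b'))))
    (hcnt : ∀ b' : g.Site, (∑ i, if b' ∈ S i then (1 : ℝ) else 0) ≤ N) :
    B6RandomWalk.HasMajorant (g := B9Thm34Ext.toB6 g R H) (fun x : g.Site => x) (∑ i, Tm i)
      (fun (a b' : g.Site) => N * (Θ * Real.exp (-(ρ * δ₀ * g.dist a b')))) := by
  refine hasMajorant_localSum_right (G := B9Thm34Ext.toB6 g R H) (fun x : g.Site => x) Tm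
    (fun i (b' : g.Site) => if b' ∈ S i then (1 : ℝ) else 0)
    (fun (a b' : g.Site) => Θ * Real.exp (-(ρ * δ₀ * g.dist a b'))) N
    (fun a b' => mul_nonneg hΘ (Real.exp_nonneg _)) (fun i => ?_) hcnt
  refine B6RandomWalk.hasMajorant_mono (g := B9Thm34Ext.toB6 g R H) _ (hTm i) fun (a b' : g.Site) => ?_
  have hE : 0 ≤ Θ * Real.exp (-(ρ * δ₀ * g.dist a b')) := mul_nonneg hΘ (Real.exp_nonneg _)
  by_cases ha : a ∈ Sχ i
  · simp only [ha, if_true, zero_mul]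
    exact mul_nonneg (by split_ifs <;> norm_num) hE
  · simp only [ha, if_false, one_mul]
    exact le_of_eq (by ring)

/-- The small factor made a power of M: *"Hence the part of the exponential factor can be estimated by e^{−(1/4)δ₀M}"*
and *"we attach the factor 8δ₀⁻¹M⁻¹"* (p. 411) — for separation D_sep ≧ M > 0 and a_sepδ₀ > 0:
e^{−a_sepδ₀D_sep} ≦ (a_sepδ₀M)⁻¹ (e^{−s} ≦ s⁻¹, gen-1's `B9.exp_neg_le_inv`).  So the Θ of `firstSum_majorant` is
O(M⁻¹) = κB₀Cc₁(a_sepδ₀)⁻¹·M⁻¹. [cite: Balaban1985BackgroundPropagators, p.411] -/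
theorem firstSum_small_factor (asep δ₀ Dsep M : ℝ) (ha : 0 < asep * δ₀) (hM : 0 < M) (hD : M ≤ Dsep) :
    Real.exp (-(asep * δ₀ * Dsep)) ≤ (asep * δ₀ * M)⁻¹ := by
  have h1 : Real.exp (-(asep * δ₀ * Dsep)) ≤ Real.exp (-(asep * δ₀ * M)) := by
    refine Real.exp_le_exp.mpr ?_
    have := mul_le_mul_of_nonneg_left hD ha.le
    linarith
  exact h1.trans (B9.exp_neg_le_inv _ (mul_pos ha hM))

/-- R = −(R₁ + R₂ + R₃) is small when the three sums are: majorants θ₁, θ₂, θ₃ (times e^{−r·d}) add up.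
[cite: Balaban1985BackgroundPropagators, (3.95)–(3.96) p.411] -/
theorem r_majorant_of_three (r θ₁ θ₂ θ₃ : ℝ) {R₁ R₂ R₃ : Module.End ℝ (g.Site → ℝ)}
    (h₁ : B6RandomWalk.HasMajorant (g := B9Thm34Ext.toB6 g R H) (fun x : g.Site => x) R₁
      (fun a b => θ₁ * Real.exp (-(r * g.dist a b))))
    (h₂ : B6RandomWalk.HasMajorant (g := B9Thm34Ext.toB6 g R H) (fun x : g.Site => x) R₂
      (fun a b => θ₂ * Real.exp (-(r * g.dist a b))))
    (h₃ : B6RandomWalk.HasMajorant (g := B9Thm34Ext.toB6 g R H) (fun x : g.Site => x) R₃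
      (fun a b => θ₃ * Real.exp (-(r * g.dist a b)))) :
    B6RandomWalk.HasMajorant (g := B9Thm34Ext.toB6 g R H) (fun x : g.Site => x) (-(R₁ + R₂ + R₃))
      (fun a b => (θ₁ + θ₂ + θ₃) * Real.exp (-(r * g.dist a b))) := by
  rw [B9Thm34Inv.hasMajorant_id_iff] at h₁ h₂ h₃ ⊢
  intro y y'
  rw [B9Thm34Inv.entry_neg, abs_neg]
  have e : B9Thm34Inv.entry (R₁ + R₂ + R₃) y y' =
      B9Thm34Inv.entry R₁ y y' + B9Thm34Inv.entry R₂ y y' + B9Thm34Inv.entry R₃ y y' := by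
    simp [B9Thm34Inv.entry]
  rw [e]
  calc |B9Thm34Inv.entry R₁ y y' + B9Thm34Inv.entry R₂ y y' + B9Thm34Inv.entry R₃ y y'|
      ≤ |B9Thm34Inv.entry R₁ y y'| + |B9Thm34Inv.entry R₂ y y'| + |B9Thm34Inv.entry R₃ y y'| := abs_add_three _ _ _
    _ ≤ θ₁ * Real.exp (-(r * g.dist y y')) + θ₂ * Real.exp (-(r * g.dist y y')) +
          θ₃ * Real.exp (-(r * g.dist y y')) := add_le_add (add_le_add (h₁ y y') (h₂ y y')) (h₃ y y')
    _ = _ := by ring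

end FirstSum

/-! ## §3  Theorem 3.9 ⇒ Theorem 3.2: the sum over the walks of (3.98) with the term bounds (3.99) -/

section Thm39

variable {g : B9.Geometry} [Fintype g.Site] [DecidableEq g.Site] {R : ℝ} {H : Prop} {X : Type}

/-- **The (3.99)-shape bound of a walk term from factor majorants** (Corollary 3.8's mechanism (3.91)–(3.94), p. 410,
with a general head weight): if the leading factor R′₀(X₀) has the majorant 1_{S₀}(y)W₀(y)e^{−δ₀d(y,z)} (W₀ ≧ 0; in (3.99)
W₀(y) = O(1)(L^jη)^{−4}: h_□C_□h_□ by (3.48)), the factors R′_{αᵢ}(Xᵢ), i ≧ 1, the majorants 1_{Sᵢ}(y)θe^{−δ₀d(y,z)}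
(Sᵢ = Xᵢ ∩ 𝔅; *"satisfies a bound of the type (3.89)"*), (2.61) of [4] holds at the exponent α and dω(y, y′) is an
admissible lower bound of the path lengths through S₁, …, Sₙ ((3.93) *"but the infimum is taken over yᵢ ∈ Xᵢ ∩ 𝔅"*;
d(y, y′) is one by `B9Thm37Sum.LB_dist`), then the term has the majorant 1_{S₀}(y)W₀(y)(θc₁(α))ⁿe^{−(1−α)δ₀dω(y,y′)} —
(3.99) with O(M^{−1/2})^{|ω|}M^{−½|ω|} = (θc₁(α))ⁿ and the rate (1 − α)δ₀ (= ½δ₀ for α = ½).  Typed, as gen-4's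
`cor38_walk_majorant`, for factors acting on ONE function space X with block map `blk` (the heteromorphic factors of
p. 413 are not modelled). [cite: Balaban1985BackgroundPropagators, Thm 3.9 (3.99) p.413 + Cor. 3.8 p.410] -/
theorem term399_majorant (blk : X → g.Site) (d : ℕ) (δ₀ α θ : ℝ) (W₀ : g.Site → ℝ) (S : ℕ → Finset g.Site)
    (F : ℕ → Module.End ℝ (X → ℝ)) (dω : g.Site → g.Site → ℝ) (n : ℕ)
    (hW₀ : ∀ a, 0 ≤ W₀ a) (hθ : 0 ≤ θ) (hdnn : ∀ y y' : g.Site, 0 ≤ g.dist y y') (hαδ : 0 ≤ α * δ₀)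
    (h1αδ : 0 ≤ (1 - α) * δ₀) (h261 : B6RandomWalk.Ineq261 d (B9Thm34Ext.toB6 g R H) δ₀ α)
    (hT0 : B6RandomWalk.HasMajorant (g := B9Thm34Ext.toB6 g R H) blk (F 0)
      (fun (a b : g.Site) => if a ∈ S 0 then W₀ a * Real.exp (-(δ₀ * g.dist a b)) else 0))
    (hR : ∀ i, 1 ≤ i → i ≤ n → B6RandomWalk.HasMajorant (g := B9Thm34Ext.toB6 g R H) blk (F i)
      (fun (a b : g.Site) => if a ∈ S i then θ * Real.exp (-(δ₀ * g.dist a b)) else 0))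
    (hdω : ∀ a b : g.Site, B9Thm37Sum.LB g.dist S n a b (dω a b)) :
    B6RandomWalk.HasMajorant (g := B9Thm34Ext.toB6 g R H) blk (B9Thm37Sum.lprod F n)
      (fun (a b : g.Site) => (if a ∈ S 0 then W₀ a else 0) * (θ * B6.c1 d δ₀ α) ^ n *
        Real.exp (-((1 - α) * δ₀ * dω a b))) := by
  let w : ℕ → g.Site → ℝ := fun i a => if a ∈ S i then (if i = 0 then W₀ a else θ) else 0
  have hw0 : ∀ i a, 0 ≤ w i a := fun i a => by
    simp only [w]
    split_ifs
    · exact hW₀ a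
    · exact hθ
    · exact le_rfl
  have hwΘ : ∀ i a, 1 ≤ i → w i a ≤ θ := fun i a hi => by
    have hi' : i ≠ 0 := by omega
    simp only [w, hi', if_false]
    split_ifs
    · exact le_rfl
    · exact hθ
  have hwS : ∀ i a, 1 ≤ i → a ∉ S i → w i a = 0 := fun i a _ ha => by
    simp only [w, ha, if_false]
  have hK : ∀ i ≤ n, B6RandomWalk.HasMajorant (g := B9Thm34Ext.toB6 g R H) blk (F i)
      (fun (a b : g.Site) => w i a * Real.exp (-(δ₀ * g.dist a b))) := by
    intro i hin
    by_cases hi : i = 0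
    · subst hi
      refine B6RandomWalk.hasMajorant_mono (g := B9Thm34Ext.toB6 g R H) blk hT0 fun a b => le_of_eq ?_
      simp only [w, if_true]
      split_ifs <;> ring
    · refine B6RandomWalk.hasMajorant_mono (g := B9Thm34Ext.toB6 g R H) blk (hR i (by omega) hin) fun a b =>
        le_of_eq ?_
      simp only [w, hi, if_false]
      split_ifs <;> ring
  have hKnn : ∀ i ≤ n, ∀ (a b : g.Site), 0 ≤ w i a * Real.exp (-(δ₀ * g.dist a b)) := fun i _ a b =>
    mul_nonneg (hw0 i a) (Real.exp_nonneg _)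
  have hprod := B9Thm37Sum.hasMajorant_lprod (G := B9Thm34Ext.toB6 g R H) blk F
    (fun i (a b : g.Site) => w i a * Real.exp (-(δ₀ * g.dist a b))) n hK hKnn
  refine B6RandomWalk.hasMajorant_mono (g := B9Thm34Ext.toB6 g R H) blk hprod fun a b => ?_
  have hch := B9Thm37Sum.lchain_weight_le (St := g.Site) g.dist δ₀ α (B6.c1 d δ₀ α) θ hdnn hαδ h1αδ hθ h261 n S w
    (fun i _ a => hw0 i a) (fun i hi _ a => hwΘ i a hi) (fun i hi _ a ha => hwS i a hi ha) a b (dω a b) (hdω a b)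
  refine hch.trans (le_of_eq ?_)
  simp only [w, if_true]

/-- **The sum over the walks of (3.98), general head weight** (Proposition 1.2 [3] / Proposition 2.3 [4] route).
Index the factors (α, X) by a finite type with `nbrs c` = the admissible successors (X ∩ X′ ≠ ∅; at most D of them,
`hD`); let W ω be the term of (3.98) for the walk ω = c :: ⋯ ∈ `walksFrom nbrs n c`, with the (3.99)-type majorant
1_{S_c}(y)P(y)qⁿe^{−δ′d(y,y′)} (`hW`; P(y) = O(1)(L^jη)^{−4}, q = O(M^{−1/2})M^{−1/2}, δ′ = ½δ₀, d(ω, y, y′) ≧ d(y, y′) used;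
S_c = ∅ for the non-start factors), and let every site lie in at most N of the S_c (`hcnt`).  If Dq ≦ ½ (*"M sufficiently
large"*) then EVERY partial sum Σ_{n<m}Σ_cΣ_ω W ω has the majorant 2N·P(y)e^{−δ′d(y,y′)}, uniformly in m (geometric series,
gen-1's `B9.walkSum_le`) — gen-4's `walkSum_majorant` with (L^jη)² ↦ P(y).
[cite: Balaban1985BackgroundPropagators, Thm 3.9 (3.98)–(3.99) p.413; Balaban1984PropagatorsII, Prop. 2.3 p.238] -/
theorem walkSum_majorant_weight (blk : X → g.Site) {ι : Type} [Fintype ι] [DecidableEq ι] (nbrs : ι → Finset ι)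
    (D : ℕ) (hD : ∀ c, (nbrs c).card ≤ D) (S : ι → Finset g.Site) (W : List ι → Module.End ℝ (X → ℝ))
    (P : g.Site → ℝ) (q δ' N : ℝ) (hP : ∀ a, 0 ≤ P a) (hq : 0 ≤ q) (hN : 0 ≤ N) (hDq : (D : ℝ) * q ≤ 1 / 2)
    (hW : ∀ (n : ℕ) (c : ι), ∀ ω ∈ B9Thm37Sum.walksFrom nbrs n c,
      B6RandomWalk.HasMajorant (g := B9Thm34Ext.toB6 g R H) blk (W ω)
        (fun (a b : g.Site) => (if a ∈ S c then P a else 0) * q ^ n * Real.exp (-(δ' * g.dist a b))))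
    (hcnt : ∀ a : g.Site, (∑ c, if a ∈ S c then (1 : ℝ) else 0) ≤ N) (m : ℕ) :
    B6RandomWalk.HasMajorant (g := B9Thm34Ext.toB6 g R H) blk
      (∑ n ∈ Finset.range m, ∑ c, ∑ ω ∈ B9Thm37Sum.walksFrom nbrs n c, W ω)
      (fun (a b : g.Site) => 2 * N * P a * Real.exp (-(δ' * g.dist a b))) := by
  -- level n, start factor c: at most D^n walks, each with the same majorant
  have hlevel : ∀ n c, B6RandomWalk.HasMajorant (g := B9Thm34Ext.toB6 g R H) blk
      (∑ ω ∈ B9Thm37Sum.walksFrom nbrs n c, W ω)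
      (fun (a b : g.Site) => (D : ℝ) ^ n * ((if a ∈ S c then P a else 0) * q ^ n *
        Real.exp (-(δ' * g.dist a b)))) := by
    intro n c
    refine B6RandomWalk.hasMajorant_mono (g := B9Thm34Ext.toB6 g R H) blk
      (B9Thm37Sum.hasMajorant_finsetSum (G := B9Thm34Ext.toB6 g R H) blk (B9Thm37Sum.walksFrom nbrs n c) W
        (fun _ (a b : g.Site) => (if a ∈ S c then P a else 0) * q ^ n * Real.exp (-(δ' * g.dist a b)))
        (hW n c)) fun a b => ?_
    have hnn : 0 ≤ (if a ∈ S c then P a else 0) * q ^ n * Real.exp (-(δ' * g.dist a b)) :=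
      mul_nonneg (mul_nonneg (by split_ifs <;> first | exact hP a | exact le_rfl) (pow_nonneg hq n))
        (Real.exp_nonneg _)
    rw [Finset.sum_const, nsmul_eq_mul]
    refine mul_le_mul_of_nonneg_right ?_ hnn
    exact_mod_cast B9Thm37Sum.card_walksFrom_le nbrs hD n c
  -- sum over the start factor: the overlap count N
  have hn : ∀ n, B6RandomWalk.HasMajorant (g := B9Thm34Ext.toB6 g R H) blk
      (∑ c, ∑ ω ∈ B9Thm37Sum.walksFrom nbrs n c, W ω)
      (fun (a b : g.Site) => N * P a * Real.exp (-(δ' * g.dist a b)) * ((D : ℝ) * q) ^ n) := by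
    intro n
    refine B6RandomWalk.hasMajorant_mono (g := B9Thm34Ext.toB6 g R H) blk
      (B9Thm37Sum.hasMajorant_finsetSum (G := B9Thm34Ext.toB6 g R H) blk Finset.univ _ _ fun c _ => hlevel n c)
      fun a b => ?_
    have hE : 0 ≤ P a * Real.exp (-(δ' * g.dist a b)) * ((D : ℝ) * q) ^ n :=
      mul_nonneg (mul_nonneg (hP a) (Real.exp_nonneg _)) (pow_nonneg (mul_nonneg (Nat.cast_nonneg D) hq) n)
    calc ∑ c, (D : ℝ) ^ n * ((if a ∈ S c then P a else 0) * q ^ n * Real.exp (-(δ' * g.dist a b)))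
        = (∑ c, if a ∈ S c then (1 : ℝ) else 0) * (P a * Real.exp (-(δ' * g.dist a b)) * ((D : ℝ) * q) ^ n) := by
          rw [Finset.sum_mul]
          refine Finset.sum_congr rfl fun c _ => ?_
          split_ifs <;> ring
      _ ≤ N * (P a * Real.exp (-(δ' * g.dist a b)) * ((D : ℝ) * q) ^ n) := mul_le_mul_of_nonneg_right (hcnt a) hE
      _ = _ := by ring
  -- sum over n < m: geometric series with ratio Dq ≤ ½
  refine B6RandomWalk.hasMajorant_mono (g := B9Thm34Ext.toB6 g R H) blk
    (B9Thm37Sum.hasMajorant_finsetSum (G := B9Thm34Ext.toB6 g R H) blk (Finset.range m) _ _ fun n _ => hn n)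
    fun a b => ?_
  have hC : 0 ≤ N * P a * Real.exp (-(δ' * g.dist a b)) := mul_nonneg (mul_nonneg hN (hP a)) (Real.exp_nonneg _)
  have hgeom := B9.walkSum_le (N * P a * Real.exp (-(δ' * g.dist a b))) ((D : ℝ) * q) (fun _ => 1)
    (fun n => N * P a * Real.exp (-(δ' * g.dist a b)) * ((D : ℝ) * q) ^ n) hC (mul_nonneg (Nat.cast_nonneg D) hq) hDq
    (fun n => le_of_eq (one_mul _)) m
  calc ∑ n ∈ Finset.range m, N * P a * Real.exp (-(δ' * g.dist a b)) * ((D : ℝ) * q) ^ n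
      = ∑ n ∈ Finset.range m, 1 * (N * P a * Real.exp (-(δ' * g.dist a b)) * ((D : ℝ) * q) ^ n) := by
        simp only [one_mul]
    _ ≤ 2 * (N * P a * Real.exp (-(δ' * g.dist a b))) := hgeom
    _ = _ := by ring

/-- **The partial sums of (3.98) satisfy (3.48), printed kernel notation.**  With the kernels w.r.t. the pairing weight
(L^{j′}η)^d: if every term of (3.98) for a walk of length n from the start factor c satisfies the (3.99)-shape bound
|(W ω)(y, y′)| ≦ 1_{S_c}(y)A(L^jη)^{−4}(L^{j′}η)^{−d}qⁿe^{−δ′d(y,y′)} (`hW`: O(1) = A, O(M^{−1/2})M^{−1/2} = q, the printed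
e^{−½δ₀d(ω,y,y′)} ≦ e^{−½δ₀d(y,y′)} already used, δ′ = ½δ₀), the successor structure has ≦ D branches, every site lies in at
most N start localizations and Dq ≦ ½, then for every m and all y ∈ Λ_j, y′ ∈ Λ_{j′}:
|(Σ_{n<m}Σ_cΣ_ω W ω)(y, y′)| ≦ 2NA(L^jη)^{−4}(L^{j′}η)^{−d}e^{−δ′d(y,y′)} — (3.48) with **B₀ ↦ 2NA, δ₀ ↦ δ′**.
[cite: Balaban1985BackgroundPropagators, Thm 3.9 (3.98)–(3.99) p.413 + Thm 3.2 (3.48) p.398] -/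
theorem partialSum_kernel_348 (d : ℕ) {ι : Type} [Fintype ι] [DecidableEq ι] (nbrs : ι → Finset ι)
    (D : ℕ) (hD : ∀ c, (nbrs c).card ≤ D) (S : ι → Finset g.Site) (W : List ι → Module.End ℝ (g.Site → ℝ))
    (A q δ' N : ℝ) (hA : 0 ≤ A) (hq : 0 ≤ q) (hN : 0 ≤ N) (hDq : (D : ℝ) * q ≤ 1 / 2)
    (hlen : ∀ y : g.Site, 0 < g.len y)
    (hW : ∀ (n : ℕ) (c : ι), ∀ ω ∈ B9Thm37Sum.walksFrom nbrs n c, ∀ y y' : g.Site,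
      |B9Thm34Inv.ker (B9Thm34Inv.vol g d) (W ω) y y'| ≤
        (if y ∈ S c then A * g.len y ^ (-(4 : ℝ)) else 0) * g.len y' ^ (-(d : ℝ)) * q ^ n *
          Real.exp (-(δ' * g.dist y y')))
    (hcnt : ∀ a : g.Site, (∑ c, if a ∈ S c then (1 : ℝ) else 0) ≤ N) (m : ℕ) (y y' : g.Site) :
    |B9Thm34Inv.ker (B9Thm34Inv.vol g d)
        (∑ n ∈ Finset.range m, ∑ c, ∑ ω ∈ B9Thm37Sum.walksFrom nbrs n c, W ω) y y'| ≤
      2 * N * A * g.len y ^ (-(4 : ℝ)) * g.len y' ^ (-(d : ℝ)) * Real.exp (-(δ' * g.dist y y')) := by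
  have hvol := B9Thm34Inv.vol_pos d hlen
  set P : g.Site → ℝ := fun y => A * g.len y ^ (-(4 : ℝ)) with hPdef
  have hP : ∀ a, 0 ≤ P a := fun a => mul_nonneg hA (Real.rpow_nonneg (hlen a).le _)
  have hWe : ∀ (n : ℕ) (c : ι), ∀ ω ∈ B9Thm37Sum.walksFrom nbrs n c,
      B6RandomWalk.HasMajorant (g := B9Thm34Ext.toB6 g 0 True) (fun x : g.Site => x) (W ω)
        (fun (a b : g.Site) => (if a ∈ S c then P a else 0) * q ^ n * Real.exp (-(δ' * g.dist a b))) := by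
    intro n c ω hω
    refine (B9Thm34Inv.hasMajorant_id_iff _ _).mpr fun z z' =>
      (B9Thm34Inv.ker_le_iff (B9Thm34Inv.vol g d) (hvol z') (W ω) z _).mp ?_
    refine (hW n c ω hω z z').trans (le_of_eq ?_)
    rw [B9Thm34Inv.vol_inv d hlen z']
    simp only [hPdef]
    split_ifs <;> ring
  have hmaj := walkSum_majorant_weight (R := 0) (H := True) (fun x : g.Site => x) nbrs D hD S W P q δ' N hP hq hN hDq
    hWe hcnt m
  have hent := (B9Thm34Inv.hasMajorant_id_iff _ _).mp hmaj y y'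
  have hk := (B9Thm34Inv.ker_le_iff (B9Thm34Inv.vol g d) (hvol y') _ y _).mpr hent
  refine hk.trans (le_of_eq ?_)
  rw [B9Thm34Inv.vol_inv d hlen y', hPdef]
  simp only
  ring

omit [Fintype g.Site] in
/-- **Limits keep kernel bounds** (*"The series is convergent in the weighted supremum norm on 𝔅"* — on the finite set
𝔅 this is kernelwise convergence): if the kernels of the partial sums S_m are bounded by K(y, y′) uniformly in m and
converge to the kernel of T, then |T(y, y′)| ≦ K(y, y′). [folklore] -/
theorem kernel_bound_of_limit (w : g.Site → ℝ) (Sp : ℕ → Module.End ℝ (g.Site → ℝ))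
    (T : Module.End ℝ (g.Site → ℝ)) (K : g.Site → g.Site → ℝ)
    (hS : ∀ m y y', |B9Thm34Inv.ker w (Sp m) y y'| ≤ K y y')
    (hconv : ∀ y y', Filter.Tendsto (fun m => B9Thm34Inv.ker w (Sp m) y y') Filter.atTop
      (nhds (B9Thm34Inv.ker w T y y'))) (y y' : g.Site) :
    |B9Thm34Inv.ker w T y y'| ≤ K y y' :=
  le_of_tendsto' ((hconv y y').abs) fun m => hS m y y'

/-- **"This theorem implies Theorem 3.2"** (p. 413, last line of the proof discussion of Theorem 3.9), kernel level,
constants explicit.  If T is the inverse of L = Q′G′²Q′\* (`hTL`, `hLT`), the partial sums of the walk expansion (3.98)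
converge kernelwise on 𝔅 to T (`hconv` — the representation (3.98) *"convergent in the weighted supremum norm"*), every
term obeys the (3.99)-shape bound with O(1) = A, O(M^{−1/2})M^{−1/2} = q, rate δ′ (`hW`), the walks branch at most D-fold,
the start localizations overlap at most N-fold and Dq ≦ ½ (*"for M sufficiently large"*), then the inverse satisfies
Theorem 3.2's (3.48): |(Q′G′²Q′\*)⁻¹(y, y′)| ≦ 2NA(L^jη)^{−4}(L^{j′}η)^{−d}e^{−δ′d(y,y′)}, y ∈ Λ_j, y′ ∈ Λ_{j′} — the
kernel-level content of the sibling's abstract leaf `B9.RWKernelSumYields` / `B9.thm32_of_thm39`.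
[cite: Balaban1985BackgroundPropagators, Thm 3.9 p.413 ⇒ Thm 3.2 (3.48) p.398] -/
theorem thm32_of_thm39_kernel (d : ℕ) {ι : Type} [Fintype ι] [DecidableEq ι] (nbrs : ι → Finset ι)
    (D : ℕ) (hD : ∀ c, (nbrs c).card ≤ D) (S : ι → Finset g.Site) (W : List ι → Module.End ℝ (g.Site → ℝ))
    (A q δ' N : ℝ) (hA : 0 ≤ A) (hq : 0 ≤ q) (hN : 0 ≤ N) (hDq : (D : ℝ) * q ≤ 1 / 2)
    (hlen : ∀ y : g.Site, 0 < g.len y)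
    {L T : Module.End ℝ (g.Site → ℝ)} (hTL : T * L = 1) (hLT : L * T = 1)
    (hW : ∀ (n : ℕ) (c : ι), ∀ ω ∈ B9Thm37Sum.walksFrom nbrs n c, ∀ y y' : g.Site,
      |B9Thm34Inv.ker (B9Thm34Inv.vol g d) (W ω) y y'| ≤
        (if y ∈ S c then A * g.len y ^ (-(4 : ℝ)) else 0) * g.len y' ^ (-(d : ℝ)) * q ^ n *
          Real.exp (-(δ' * g.dist y y')))
    (hcnt : ∀ a : g.Site, (∑ c, if a ∈ S c then (1 : ℝ) else 0) ≤ N)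
    (hconv : ∀ y y' : g.Site, Filter.Tendsto
      (fun m => B9Thm34Inv.ker (B9Thm34Inv.vol g d)
        (∑ n ∈ Finset.range m, ∑ c, ∑ ω ∈ B9Thm37Sum.walksFrom nbrs n c, W ω) y y')
      Filter.atTop (nhds (B9Thm34Inv.ker (B9Thm34Inv.vol g d) T y y'))) :
    T * L = 1 ∧ L * T = 1 ∧ ∀ y y' : g.Site, |B9Thm34Inv.ker (B9Thm34Inv.vol g d) T y y'| ≤
      2 * N * A * g.len y ^ (-(4 : ℝ)) * g.len y' ^ (-(d : ℝ)) * Real.exp (-(δ' * g.dist y y')) :=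
  ⟨hTL, hLT, kernel_bound_of_limit (B9Thm34Inv.vol g d) _ T _
    (fun m y y' => partialSum_kernel_348 d nbrs D hD S W A q δ' N hA hq hN hDq hlen hW hcnt m y y')
    hconv⟩

end Thm39

end Literature.MathematicalPhysics.QuantumFieldTheory.Balaban1983to89.B9Thm39Sum
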